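import Mathlib
import Literature.Analysis.FluidPDE.LocalTypeI
import HarnessLib

/-!
# Route RootDecompLitSlice — brick B5 of the aside D₁ `DarkBallSpreads` (stmt-NavierStokesRegularity-29566):
# the complement of a closed `ℋ¹`-null set in `ℝ³` is path connected

Row E20 of the decomp-ns census (THE DARK-BALL ENGINE LEDGER) lists, among the bricks of the expected theorem
D₁ (`DarkBallSpreads`; crux D `NoDarkBall` 29563 ⟺ D₁ by name), brick **B5**: «a closed `ℋ¹`-null set does not
separate `ℝ³`» — flagged load-bearing by the critic (CRITIC-LEDGER row 320: the open–closed propagation of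
«`curl u(T) ≡ 0` near `x`» runs over the REGULAR part `ℝ³ ∖ Σ_T` of the terminal slice, which must be connected;
`ℋ¹(Σ_T) = 0` is brick B0, `Theorems/RootDecompLitSliceDarkBallSpreadsTerminalSliceNullity.lean`).

This file proves it by an elementary COORDINATE-PLANE argument (no degree theory, no capacity):
* a coordinate `x ↦ x i` is `1`-Lipschitz, so the coordinate projection of an `ℋ¹`-null set is Lebesgue-null in
  `ℝ` (`LipschitzWith.hausdorffMeasure_image_le`, `MeasureTheory.hausdorffMeasure_real`); hence every
  non-degenerate interval of heights contains an `a` whose coordinate plane `{x i = a}` MISSES `Σ` entirely;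
* from `x ∉ Σ` (closed) move inside a small ball along `e₀` onto such a plane `{x₀ = a}`, inside that plane along
  `e₁` onto a plane `{x₁ = b}` missing `Σ`, across it, and back: six convex pieces, all in `ℝ³ ∖ Σ`.

Main results: `isPathConnected_compl_of_hausdorffMeasure_eq_zero` (closed `Σ ⊆ ℝ³`, `μH[1] Σ = 0` ⟹ `Σᶜ`
path connected) and the D₁-facing corollary `isPathConnected_compl_terminal_backwardSingularSlice_of_isClosed`
(for the backward-singular terminal slice of brick B0, given its closedness).

HONEST FRAMING: elementary geometric measure theory; closes no item; nothing here bears on NS regularity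
(rung 0). Lands `--supports stmt-NavierStokesRegularity-29566` (census instrument decomp-ns-census-1 g28).
-/

noncomputable section

open MeasureTheory Set Metric Function
open scoped ENNReal NNReal Topology

-- the summit and its single sub-problem share the name (CONVENTIONS §1), as in every Theorems file
set_option linter.dupNamespace false

namespace Summit.NavierStokesRegularity.NavierStokesRegularity.Theorems

/-! ### Coordinate projections of `ℋ¹`-null sets -/

/-- A coordinate of `ℝ³` (Euclidean norm) is `1`-Lipschitz. [folklore] -/
theorem lipschitzWith_euclidean_coord (i : Fin 3) :
    LipschitzWith 1 (fun x : EuclideanSpace ℝ (Fin 3) => x i) :=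
  LipschitzWith.of_dist_le_mul fun x y => by
    rw [NNReal.coe_one, one_mul, dist_eq_norm, dist_eq_norm, ← PiLp.sub_apply]
    exact PiLp.norm_apply_le (x - y) i

/-- The coordinate projection of an `ℋ¹`-null subset of `ℝ³` is Lebesgue-null in `ℝ`. [folklore] -/
theorem volume_image_coord_eq_zero_of_hausdorffMeasure_eq_zero {S : Set (EuclideanSpace ℝ (Fin 3))}
    (hS : μH[1] S = 0) (i : Fin 3) : volume ((fun x : EuclideanSpace ℝ (Fin 3) => x i) '' S) = 0 := by
  rw [← hausdorffMeasure_real]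
  refine le_antisymm ?_ bot_le
  calc μH[1] ((fun x : EuclideanSpace ℝ (Fin 3) => x i) '' S)
      ≤ (1 : ℝ≥0) ^ (1 : ℝ) * μH[1] S :=
        (lipschitzWith_euclidean_coord i).hausdorffMeasure_image_le zero_le_one S
    _ = 0 := by rw [hS, mul_zero]

/-- Every non-degenerate interval of heights contains one whose coordinate plane misses an `ℋ¹`-null set.
[folklore] -/
theorem exists_coord_plane_disjoint {S : Set (EuclideanSpace ℝ (Fin 3))} (hS : μH[1] S = 0) (i : Fin 3)
    {lo hi : ℝ} (h : lo < hi) : ∃ a ∈ Ioo lo hi, ∀ z ∈ S, z i ≠ a := by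
  by_contra H
  push Not at H
  have hsub : Ioo lo hi ⊆ (fun x : EuclideanSpace ℝ (Fin 3) => x i) '' S := by
    intro a ha
    obtain ⟨z, hz, hza⟩ := H a ha
    exact ⟨z, hz, hza⟩
  have hle := measure_mono (μ := volume) hsub
  rw [volume_image_coord_eq_zero_of_hausdorffMeasure_eq_zero hS i, Real.volume_Ioo, nonpos_iff_eq_zero,
    ENNReal.ofReal_eq_zero] at hle
  linarith

/-! ### Coordinate planes and coordinate moves -/

/-- Coordinate planes `{x i = a}` are convex. [folklore] -/
theorem convex_coord_plane (i : Fin 3) (a : ℝ) : Convex ℝ {z : EuclideanSpace ℝ (Fin 3) | z i = a} := by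
  intro z hz w hw s t _ _ hst
  simp only [mem_setOf_eq] at hz hw ⊢
  rw [PiLp.add_apply, PiLp.smul_apply, PiLp.smul_apply, hz, hw, smul_eq_mul, smul_eq_mul, ← add_mul, hst,
    one_mul]

/-- Two points of a convex subset of `F` are joined in `F`. [folklore] -/
theorem joinedIn_of_convex {C F : Set (EuclideanSpace ℝ (Fin 3))} (hC : Convex ℝ C) (hCF : C ⊆ F)
    {x y : EuclideanSpace ℝ (Fin 3)} (hx : x ∈ C) (hy : y ∈ C) : JoinedIn F x y :=
  ((hC.isPathConnected ⟨x, hx⟩).joinedIn x hx y hy).mono hCF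

/-- The coordinate move `x + (a - x i) e_i`: its `i`-th coordinate is `a`, the others are those of `x`.
[folklore] -/
theorem coord_move_apply (x : EuclideanSpace ℝ (Fin 3)) (i j : Fin 3) (a : ℝ) :
    (x + (a - x i) • EuclideanSpace.single i (1 : ℝ)) j = if j = i then a else x j := by
  rw [PiLp.add_apply, PiLp.smul_apply, EuclideanSpace.single, PiLp.single_apply, smul_eq_mul]
  split_ifs with h
  · subst h; ring
  · ring

/-- The coordinate move stays within distance `|a - x i|`. [folklore] -/
theorem dist_coord_move (x : EuclideanSpace ℝ (Fin 3)) (i : Fin 3) (a : ℝ) :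
    dist (x + (a - x i) • EuclideanSpace.single i (1 : ℝ)) x = |a - x i| := by
  rw [dist_eq_norm, add_sub_cancel_left, norm_smul, EuclideanSpace.single, PiLp.norm_single, norm_one, mul_one,
    Real.norm_eq_abs]

/-! ### The complement of a closed `ℋ¹`-null set is path connected -/

/-- **Brick B5.** A closed subset of `ℝ³` of one-dimensional Hausdorff measure zero does not separate:
its complement is path connected. Proof by coordinate planes missing `S` (which exist in every height
window since the coordinate projections of `S` are Lebesgue-null) and straight moves inside small balls
and inside those planes. [folklore] -/
theorem isPathConnected_compl_of_hausdorffMeasure_eq_zero {S : Set (EuclideanSpace ℝ (Fin 3))}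
    (hSc : IsClosed S) (hS : μH[1] S = 0) : IsPathConnected Sᶜ := by
  -- abbreviations
  have plane_sub : ∀ (i : Fin 3) (a : ℝ), (∀ z ∈ S, z i ≠ a) →
      {z : EuclideanSpace ℝ (Fin 3) | z i = a} ⊆ Sᶜ := fun i a ha z hz hzS => ha z hzS hz
  -- a plane `{x₁ = b}` missing `S`; it also witnesses non-emptiness
  obtain ⟨b, -, hb⟩ := exists_coord_plane_disjoint hS 1 zero_lt_one
  have h01 : (0 : Fin 3) ≠ 1 := by decide
  have h10 : (1 : Fin 3) ≠ 0 := by decide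
  refine ⟨EuclideanSpace.single (1 : Fin 3) b, plane_sub 1 b hb (by simp), ?_⟩
  -- it suffices to join any two points of the complement
  suffices key : ∀ x ∈ Sᶜ, ∀ y ∈ Sᶜ, JoinedIn Sᶜ x y by
    intro y hy
    exact key _ (plane_sub 1 b hb (by simp)) y hy
  -- from any `x ∉ S`: a point `x''` with `x'' 1 = b`, joined to `x` in `Sᶜ`
  have reach : ∀ x ∈ Sᶜ, ∃ x'' : EuclideanSpace ℝ (Fin 3), x'' 1 = b ∧ JoinedIn Sᶜ x x'' := by
    intro x hx
    obtain ⟨δ, hδ, hball⟩ := Metric.isOpen_iff.1 hSc.isOpen_compl x hx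
    -- a plane `{x₀ = a}` missing `S` with `|a - x 0| < δ`
    obtain ⟨a, ha, haS⟩ := exists_coord_plane_disjoint hS 0 (show x 0 - δ < x 0 + δ by linarith)
    set x' : EuclideanSpace ℝ (Fin 3) := x + (a - x 0) • EuclideanSpace.single 0 (1 : ℝ) with hx'
    have hx'0 : x' 0 = a := by rw [hx', coord_move_apply]; simp
    have hx'ball : x' ∈ ball x δ := by
      rw [mem_ball, hx', dist_coord_move, abs_lt]
      constructor <;> linarith [ha.1, ha.2]
    have j1 : JoinedIn Sᶜ x x' :=
      joinedIn_of_convex (convex_ball x δ) hball (mem_ball_self hδ) hx'ball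
    -- inside the plane `{x₀ = a}` move the second coordinate to `b`
    set x'' : EuclideanSpace ℝ (Fin 3) := x' + (b - x' 1) • EuclideanSpace.single 1 (1 : ℝ) with hx''
    have hx''1 : x'' 1 = b := by rw [hx'', coord_move_apply]; simp
    have hx''0 : x'' 0 = a := by rw [hx'', coord_move_apply, if_neg h01, hx'0]
    have j2 : JoinedIn Sᶜ x' x'' :=
      joinedIn_of_convex (convex_coord_plane 0 a) (plane_sub 0 a haS) hx'0 hx''0
    exact ⟨x'', hx''1, j1.trans j2⟩
  intro x hx y hy
  obtain ⟨x'', hx'', jx⟩ := reach x hx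
  obtain ⟨y'', hy'', jy⟩ := reach y hy
  have j3 : JoinedIn Sᶜ x'' y'' :=
    joinedIn_of_convex (convex_coord_plane 1 b) (plane_sub 1 b hb) hx'' hy''
  exact (jx.trans j3).trans jy.symm

/-- **Brick B5 for the terminal slice of D₁** (`DarkBallSpreads`, stmt-29566): if the backward-singular terminal
slice `Σ_T = {x | IsBackwardSingularPoint u (T, x)}` is closed, then — its `ℋ¹`-measure being zero by brick B0
for the Clay-class solutions of D₁ — its complement, the regular part of the terminal slice, is path connected.
Stated with the nullity as a hypothesis so that this file stays independent of B0's imports. [this file] -/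
theorem isPathConnected_compl_terminal_backwardSingularSlice_of_isClosed
    {u : ℝ → EuclideanSpace ℝ (Fin 3) → EuclideanSpace ℝ (Fin 3)} {T : ℝ}
    (hclosed : IsClosed {x : EuclideanSpace ℝ (Fin 3) |
      Literature.Analysis.FluidPDE.IsBackwardSingularPoint u ((T : ℝ), x)})
    (hnull : μH[1] {x : EuclideanSpace ℝ (Fin 3) |
      Literature.Analysis.FluidPDE.IsBackwardSingularPoint u ((T : ℝ), x)} = 0) :
    IsPathConnected {x : EuclideanSpace ℝ (Fin 3) |
      Literature.Analysis.FluidPDE.IsBackwardSingularPoint u ((T : ℝ), x)}ᶜ :=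
  isPathConnected_compl_of_hausdorffMeasure_eq_zero hclosed hnull

end Summit.NavierStokesRegularity.NavierStokesRegularity.Theorems
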